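import Literature.Topology.FourManifolds.MilnorModelTrajectories
import Literature.Topology.FourManifolds.LocallyFlat
import HarnessLib

/-!
# Milnor's coordinates `(x⃗, y⃗) ∈ Rᴷ × Rᴸ = Rᵐ`: the coordinate embeddings and projections

Topic `Literature/Topology/FourManifolds` (linear-algebra infrastructure for the fact seat
`provefact-Literature.Topology.FourManifolds.Cobord-8cc1f19d3e`, the named fact
`Literature.Topology.FourManifolds.Cobordism.Milnor1965_leftHandSphere_embedded` of
`HCobordismAuxiliaryPair.lean`: Milnor's left-hand sphere is an embedded sphere, Def. 3.9).
Milnor, *Lectures on the h-cobordism theorem* (1965), Def. 3.1 (2) (PDF p. 12 of the held copy)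
writes the coordinates about a critical point of index `λ` as
*"`(x⃗, y⃗) = (x₁, …, x_λ, x_{λ+1}, …, xₙ)`"*, `x⃗ ∈ R^λ`, `y⃗ ∈ R^{n-λ}` (PDF p. 16), and Def. 3.9
(PDF p. 16) parametrises the level `V₋ε` near the left-hand sphere by
`S^{λ-1} × OD^{n-λ} ∋ (u, θ v) ↦ g(ε u cosh θ, ε v sinh θ)`.  The tree's model space is the
single Euclidean space `EuclideanSpace ℝ (Fin m)` with the splitting encoded by the index bound
`(i : ℕ) < K` (`Literature.Topology.FourManifolds.milnorModelField`,
`Literature.Topology.FourManifolds.sqSumLT`, `Literature.Topology.FourManifolds.sqSumGE`); to let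
the standard sphere `S^{K-1} ⊆ EuclideanSpace ℝ (Fin K)` parametrise Milnor's `x⃗`-sphere we
provide the four coordinate maps between `Rᴷ`, `Rᴸ` and `Rᵐ` (`K + L = m`) as continuous
linear maps.  Everything is proved; the only definitions are these four elementary maps (the
radial retraction `x ↦ x/‖x‖` onto the unit sphere, also needed there, is the tree's
`Literature.Topology.FourManifolds.radialProjection`, `ClosedBall.lean`, smooth off the origin by
`Literature.Topology.FourManifolds.contMDiffOn_radialProjection`, `CircleSurgeryExistence.lean`).

## Contents

* `lowerEmb K m : Rᴷ →L Rᵐ`, `x ↦ (x, 0)` — as a function this is *definitionally* the tree's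
  zero-padding `Literature.Topology.FourManifolds.euclideanInclusion K m` (`LocallyFlat.lean`);
  the same bundling exists as `Literature.Topology.FourManifolds.euclideanInclusionCLM`
  (`FramedStandardSpheres.lean`), which is not imported here so as to keep the Morse-theory
  files free of the knot-theory import closure of that file (the two continuous linear maps
  agree by `rfl` on the underlying functions); `upperEmb K L m : Rᴸ →L Rᵐ`,
  `y ↦ (0, y)` (coordinates shifted by `K`); `lowerProj K m : Rᵐ →L Rᴷ`, `upperProj K L m : Rᵐ →L Rᴸ`
  the two coordinate projections; the identities `lowerProj ∘ lowerEmb = id`,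
  `upperProj ∘ upperEmb = id`, the mixed composites vanish, `lowerEmb ∘ lowerProj + upperEmb ∘ upperProj = id`;
  `lowerEmb x` is contracting and `upperEmb y` expanding for `milnorModelField K`, so that
  `sqSumLT K (lowerEmb x + upperEmb y) = ‖x‖²`, `sqSumGE K (…) = ‖y‖²`,
  `milnorQuadratic K (…) = -‖x‖² + ‖y‖²`, and `‖lowerEmb x‖ = ‖x‖`, `‖upperEmb y‖ = ‖y‖`.

## References

* J. Milnor, *Lectures on the h-cobordism theorem*, notes by L. Siebenmann and J. Sondow,
  Princeton Mathematical Notes (1965), Def. 3.1 (PDF pp. 11–12), Def. 3.9 (PDF p. 16).  Held: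
  `lit read book:milnornd-lectures-h-cobordism-theorem`. [MilnorHCobordism1965]
-/

open scoped Manifold ContDiff Topology
open Set Function Metric

noncomputable section

namespace Literature.Topology.FourManifolds

/-! ### The coordinate embeddings and projections -/

section Splitting

variable {K L m : ℕ}

variable (K m) in
/-- **The `x⃗`-coordinates**: `x ↦ (x₁, …, x_K, 0, …, 0) ∈ Rᵐ`, the zero-padding
`euclideanInclusion K m` bundled as a continuous linear map. [cite: MilnorHCobordism1965, Def. 3.1 (2) (PDF p. 12)] -/
def lowerEmb : EuclideanSpace ℝ (Fin K) →L[ℝ] EuclideanSpace ℝ (Fin m) :=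
  LinearMap.toContinuousLinearMap
    { toFun := euclideanInclusion K m
      map_add' := fun x y => by
        ext i
        simp only [euclideanInclusion_apply, PiLp.add_apply]
        split_ifs <;> simp
      map_smul' := fun c x => by
        ext i
        simp only [euclideanInclusion_apply, PiLp.smul_apply, RingHom.id_apply, smul_eq_mul]
        split_ifs <;> simp }

/-- `lowerEmb K m` is the zero-padding `euclideanInclusion K m` as a function (definitional). [folklore] -/
theorem coe_lowerEmb : ⇑(lowerEmb K m) = euclideanInclusion K m := rfl

/-- Coordinates of `lowerEmb K m x`. [folklore] -/
@[simp] theorem lowerEmb_apply (x : EuclideanSpace ℝ (Fin K)) (i : Fin m) :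
    lowerEmb K m x i = if h : (i : ℕ) < K then x ⟨i, h⟩ else 0 := rfl

variable (K L m) in
/-- **The `y⃗`-coordinates**: `y ↦ (0, …, 0, y₁, …, y_L) ∈ Rᵐ`, the coordinates shifted by `K`
(meaningful for `K + L = m`), a continuous linear map. [cite: MilnorHCobordism1965, Def. 3.1 (2) (PDF p. 12)] -/
def upperEmb : EuclideanSpace ℝ (Fin L) →L[ℝ] EuclideanSpace ℝ (Fin m) :=
  LinearMap.toContinuousLinearMap
    { toFun := fun y => WithLp.toLp 2 fun i : Fin m =>
        if h : K ≤ (i : ℕ) ∧ (i : ℕ) - K < L then y ⟨(i : ℕ) - K, h.2⟩ else 0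
      map_add' := fun x y => by
        ext i
        simp only [PiLp.add_apply]
        split_ifs <;> simp
      map_smul' := fun c x => by
        ext i
        simp only [PiLp.smul_apply, RingHom.id_apply, smul_eq_mul]
        split_ifs <;> simp }

/-- Coordinates of `upperEmb K L m y`. [folklore] -/
@[simp] theorem upperEmb_apply (y : EuclideanSpace ℝ (Fin L)) (i : Fin m) :
    upperEmb K L m y i =
      if h : K ≤ (i : ℕ) ∧ (i : ℕ) - K < L then y ⟨(i : ℕ) - K, h.2⟩ else 0 := rfl

variable (K m) in
/-- **The projection onto the `x⃗`-coordinates** `u ↦ (u₁, …, u_K)` (meaningful for `K ≤ m`). [cite: MilnorHCobordism1965, Def. 3.1 (2) (PDF p. 12)] -/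
def lowerProj : EuclideanSpace ℝ (Fin m) →L[ℝ] EuclideanSpace ℝ (Fin K) :=
  LinearMap.toContinuousLinearMap
    { toFun := fun u => WithLp.toLp 2 fun j : Fin K => if h : (j : ℕ) < m then u ⟨j, h⟩ else 0
      map_add' := fun x y => by
        ext j
        simp only [PiLp.add_apply]
        split_ifs <;> simp
      map_smul' := fun c x => by
        ext j
        simp only [PiLp.smul_apply, RingHom.id_apply, smul_eq_mul]
        split_ifs <;> simp }

/-- Coordinates of `lowerProj K m u`. [folklore] -/
@[simp] theorem lowerProj_apply (u : EuclideanSpace ℝ (Fin m)) (j : Fin K) :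
    lowerProj K m u j = if h : (j : ℕ) < m then u ⟨j, h⟩ else 0 := rfl

variable (K L m) in
/-- **The projection onto the `y⃗`-coordinates** `u ↦ (u_{K+1}, …, u_{K+L})` (meaningful for
`K + L ≤ m`). [cite: MilnorHCobordism1965, Def. 3.1 (2) (PDF p. 12)] -/
def upperProj : EuclideanSpace ℝ (Fin m) →L[ℝ] EuclideanSpace ℝ (Fin L) :=
  LinearMap.toContinuousLinearMap
    { toFun := fun u => WithLp.toLp 2 fun j : Fin L => if h : K + (j : ℕ) < m then u ⟨K + j, h⟩ else 0
      map_add' := fun x y => by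
        ext j
        simp only [PiLp.add_apply]
        split_ifs <;> simp
      map_smul' := fun c x => by
        ext j
        simp only [PiLp.smul_apply, RingHom.id_apply, smul_eq_mul]
        split_ifs <;> simp }

/-- Coordinates of `upperProj K L m u`. [folklore] -/
@[simp] theorem upperProj_apply (u : EuclideanSpace ℝ (Fin m)) (j : Fin L) :
    upperProj K L m u j = if h : K + (j : ℕ) < m then u ⟨K + j, h⟩ else 0 := rfl

/-- `lowerProj (lowerEmb x) = x` (for `K ≤ m`). [folklore] -/
theorem lowerProj_lowerEmb (hKm : K ≤ m) (x : EuclideanSpace ℝ (Fin K)) : lowerProj K m (lowerEmb K m x) = x := by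
  ext j
  have hj : (j : ℕ) < m := lt_of_lt_of_le j.isLt hKm
  simp [hj]

/-- `upperProj (upperEmb y) = y` (for `K + L ≤ m`). [folklore] -/
theorem upperProj_upperEmb (hm : K + L ≤ m) (y : EuclideanSpace ℝ (Fin L)) : upperProj K L m (upperEmb K L m y) = y := by
  ext j
  have hj : K + (j : ℕ) < m := by have := j.isLt; omega
  simp [hj]

/-- `lowerProj (upperEmb y) = 0`. [folklore] -/
theorem lowerProj_upperEmb (y : EuclideanSpace ℝ (Fin L)) : lowerProj K m (upperEmb K L m y) = 0 := by
  ext j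
  simp only [lowerProj_apply, upperEmb_apply, PiLp.zero_apply]
  split_ifs with h1 h2
  · exfalso; have := j.isLt; omega
  · rfl
  · rfl

/-- `upperProj (lowerEmb x) = 0`. [folklore] -/
theorem upperProj_lowerEmb (x : EuclideanSpace ℝ (Fin K)) : upperProj K L m (lowerEmb K m x) = 0 := by
  ext j
  simp only [upperProj_apply, lowerEmb_apply, PiLp.zero_apply]
  split_ifs with h1 h2
  · exfalso; omega
  · rfl
  · rfl

/-- **`u = (x⃗(u), y⃗(u))`**: `lowerEmb (lowerProj u) + upperEmb (upperProj u) = u` when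
`K + L = m`. [cite: MilnorHCobordism1965, Def. 3.1 (2) (PDF p. 12)] -/
theorem lowerEmb_lowerProj_add_upperEmb_upperProj (hm : K + L = m) (u : EuclideanSpace ℝ (Fin m)) :
    lowerEmb K m (lowerProj K m u) + upperEmb K L m (upperProj K L m u) = u := by
  ext i
  simp only [PiLp.add_apply, lowerEmb_apply, lowerProj_apply, upperEmb_apply, upperProj_apply]
  by_cases hi : (i : ℕ) < K
  · rw [dif_pos hi, dif_pos i.isLt, dif_neg (fun h => absurd h.1 (not_le.2 hi)), add_zero]
  · have h2 : K ≤ (i : ℕ) ∧ (i : ℕ) - K < L := ⟨not_lt.1 hi, by have := i.isLt; omega⟩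
    have h3 : K + ((i : ℕ) - K) < m := by have := i.isLt; omega
    rw [dif_neg hi, dif_pos h2, zero_add, dif_pos h3]
    have h4 : (⟨K + ((i : ℕ) - K), h3⟩ : Fin m) = i := Fin.ext (by simp only; omega)
    rw [h4]

/-- `lowerEmb x` is a contracting vector: `milnorModelField K (lowerEmb x) = -lowerEmb x`. [cite: MilnorHCobordism1965, Def. 3.1 (2) (PDF p. 12)] -/
theorem milnorModelField_lowerEmb (x : EuclideanSpace ℝ (Fin K)) :
    milnorModelField K (lowerEmb K m x) = -lowerEmb K m x := by
  ext i
  by_cases hi : (i : ℕ) < K <;> simp [milnorModelField_apply, hi]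

/-- `upperEmb y` is an expanding vector: `milnorModelField K (upperEmb y) = upperEmb y`. [cite: MilnorHCobordism1965, Def. 3.1 (2) (PDF p. 12)] -/
theorem milnorModelField_upperEmb (y : EuclideanSpace ℝ (Fin L)) :
    milnorModelField K (upperEmb K L m y) = upperEmb K L m y := by
  ext i
  by_cases hi : (i : ℕ) < K
  · have : ¬ (K ≤ (i : ℕ) ∧ (i : ℕ) - K < L) := fun h => absurd h.1 (not_le.2 hi)
    simp [milnorModelField_apply, hi, this]
  · simp [milnorModelField_apply, hi]

/-- `‖lowerEmb x‖ = ‖x‖` (for `K ≤ m`). [folklore] -/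
theorem norm_lowerEmb (hKm : K ≤ m) (x : EuclideanSpace ℝ (Fin K)) : ‖lowerEmb K m x‖ = ‖x‖ := by
  obtain ⟨d, rfl⟩ := Nat.exists_eq_add_of_le hKm
  simp only [EuclideanSpace.norm_eq, Fin.sum_univ_add, lowerEmb_apply]
  congr 1
  simp

/-- `‖upperEmb y‖ = ‖y‖` (for `K + L = m`). [folklore] -/
theorem norm_upperEmb (hm : K + L = m) (y : EuclideanSpace ℝ (Fin L)) : ‖upperEmb K L m y‖ = ‖y‖ := by
  subst hm
  simp only [EuclideanSpace.norm_eq, Fin.sum_univ_add, upperEmb_apply]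
  congr 1
  have h1 : ∑ x : Fin K, ‖(if h : K ≤ ((Fin.castAdd L x : Fin (K + L)) : ℕ) ∧
      ((Fin.castAdd L x : Fin (K + L)) : ℕ) - K < L then y ⟨((Fin.castAdd L x : Fin (K + L)) : ℕ) - K, h.2⟩
      else 0)‖ ^ 2 = 0 := by
    refine Finset.sum_eq_zero fun x _ => ?_
    have : ¬ (K ≤ ((Fin.castAdd L x : Fin (K + L)) : ℕ) ∧ ((Fin.castAdd L x : Fin (K + L)) : ℕ) - K < L) :=
      fun h => absurd h.1 (not_le.2 (by simp))
    rw [dif_neg this]; simp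
  rw [h1, zero_add]
  refine Finset.sum_congr rfl fun j _ => ?_
  have h2 : K ≤ ((Fin.natAdd K j : Fin (K + L)) : ℕ) ∧ ((Fin.natAdd K j : Fin (K + L)) : ℕ) - K < L := by
    simp
  rw [dif_pos h2]
  have h3 : (⟨((Fin.natAdd K j : Fin (K + L)) : ℕ) - K, h2.2⟩ : Fin L) = j := Fin.ext (by simp)
  rw [h3]

/-- **`|x⃗|² = ‖x‖²`** on `(x, y)`: `sqSumLT K (lowerEmb x + upperEmb y) = ‖x‖²` (`K ≤ m`). [cite: MilnorHCobordism1965, Def. 3.1 (2) (PDF p. 12)] -/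
theorem sqSumLT_lowerEmb_add_upperEmb (hKm : K ≤ m) (x : EuclideanSpace ℝ (Fin K)) (y : EuclideanSpace ℝ (Fin L)) :
    sqSumLT K (lowerEmb K m x + upperEmb K L m y) = ‖x‖ ^ 2 := by
  rw [sqSumLT_add_eq_norm_sq (milnorModelField_lowerEmb x) (milnorModelField_upperEmb y),
    norm_lowerEmb hKm]

/-- **`|y⃗|² = ‖y‖²`** on `(x, y)`: `sqSumGE K (lowerEmb x + upperEmb y) = ‖y‖²` (`K + L = m`). [cite: MilnorHCobordism1965, Def. 3.1 (2) (PDF p. 12)] -/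
theorem sqSumGE_lowerEmb_add_upperEmb (hm : K + L = m) (x : EuclideanSpace ℝ (Fin K)) (y : EuclideanSpace ℝ (Fin L)) :
    sqSumGE K (lowerEmb K m x + upperEmb K L m y) = ‖y‖ ^ 2 := by
  rw [sqSumGE_add_eq_norm_sq (milnorModelField_lowerEmb x) (milnorModelField_upperEmb y),
    norm_upperEmb hm]

/-- **Milnor's quadratic form on `(x, y)` is `-‖x‖² + ‖y‖²`.** [cite: MilnorHCobordism1965, Def. 3.1 (2) (PDF p. 12)] -/
theorem milnorQuadratic_lowerEmb_add_upperEmb (hm : K + L = m) (x : EuclideanSpace ℝ (Fin K)) (y : EuclideanSpace ℝ (Fin L)) :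
    milnorQuadratic K (lowerEmb K m x + upperEmb K L m y) = -‖x‖ ^ 2 + ‖y‖ ^ 2 := by
  rw [milnorQuadratic_eq, sqSumLT_lowerEmb_add_upperEmb (by omega), sqSumGE_lowerEmb_add_upperEmb hm]

/-- **Milnor's model field on `(x, y)` is `(-x, y)`.** [cite: MilnorHCobordism1965, Def. 3.1 (2) (PDF p. 12)] -/
theorem milnorModelField_lowerEmb_add_upperEmb (x : EuclideanSpace ℝ (Fin K)) (y : EuclideanSpace ℝ (Fin L)) :
    milnorModelField K (lowerEmb K m x + upperEmb K L m y) = -lowerEmb K m x + upperEmb K L m y := by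
  rw [milnorModelField_add, milnorModelField_lowerEmb, milnorModelField_upperEmb]

/-- `‖(x, y)‖² = ‖x‖² + ‖y‖²`. [folklore] -/
theorem norm_sq_lowerEmb_add_upperEmb (hm : K + L = m) (x : EuclideanSpace ℝ (Fin K)) (y : EuclideanSpace ℝ (Fin L)) :
    ‖lowerEmb K m x + upperEmb K L m y‖ ^ 2 = ‖x‖ ^ 2 + ‖y‖ ^ 2 := by
  rw [← sqSumLT_add_sqSumGE K, sqSumLT_lowerEmb_add_upperEmb (by omega),
    sqSumGE_lowerEmb_add_upperEmb hm]

/-- **A vector with `y⃗ = 0` is `(x⃗, 0)`**: if `sqSumGE K u = 0` then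
`u = lowerEmb (lowerProj u)`. [cite: MilnorHCobordism1965, Def. 3.1 (2) (PDF p. 12)] -/
theorem lowerEmb_lowerProj_of_sqSumGE_eq_zero {u : EuclideanSpace ℝ (Fin m)} (hu : sqSumGE K u = 0) :
    lowerEmb K m (lowerProj K m u) = u := by
  ext i
  simp only [lowerEmb_apply, lowerProj_apply]
  by_cases hi : (i : ℕ) < K
  · rw [dif_pos hi, dif_pos i.isLt]
  · rw [dif_neg hi, apply_eq_zero_of_sqSumGE_eq_zero hu (not_lt.1 hi)]

/-- `x⃗(x⃗, y⃗) = x⃗`: `lowerProj (lowerEmb x + upperEmb y) = x` (`K ≤ m`). [folklore] -/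
theorem lowerProj_lowerEmb_add_upperEmb (hKm : K ≤ m) (x : EuclideanSpace ℝ (Fin K)) (y : EuclideanSpace ℝ (Fin L)) :
    lowerProj K m (lowerEmb K m x + upperEmb K L m y) = x := by
  rw [map_add, lowerProj_lowerEmb hKm, lowerProj_upperEmb, add_zero]

/-- `y⃗(x⃗, y⃗) = y⃗`: `upperProj (lowerEmb x + upperEmb y) = y` (`K + L ≤ m`). [folklore] -/
theorem upperProj_lowerEmb_add_upperEmb (hm : K + L ≤ m) (x : EuclideanSpace ℝ (Fin K)) (y : EuclideanSpace ℝ (Fin L)) :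
    upperProj K L m (lowerEmb K m x + upperEmb K L m y) = y := by
  rw [map_add, upperProj_lowerEmb, upperProj_upperEmb hm, zero_add]

end Splitting


end Literature.Topology.FourManifolds
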